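import Mathlib
import Summits.ValiantsHypothesis.ValiantsHypothesis.Theorems.BinomialElusiveBinomialCandidatePolarNoCommonZero

/-!
# Crux `BinomialElusive.BinomialCandidate` (stmt-ValiantsHypothesis-7392), line `registered`,
# skeleton v4 — stub `stub_infinityCommonZero`: the first peeling step at the place over `x = ∞`

The registered stub `stub_infinityCommonZero` of the crux
`Summit.ValiantsHypothesis.ValiantsHypothesis.Theses.BinomialElusive.BinomialCandidate`.
Let `Γ : ℂ^s → ℂ^m` be quadratic (`totalDegree (Γ i) ≤ 2`), `N ≥ 1`, `a i < b i`, and let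
`p ∈ ℂ((t))^s` be a formal Laurent solution of `Γ_i(p) = t^{-N a_i} + t^{-N b_i}` (a solution at the
place over `x = ∞`, produced by the sibling stub `stub_infinityGlue`).  Then

* `p` has a pole: otherwise no `p j` has a coefficient at a negative exponent, hence neither has
  any `Γ_i(p)` (`InfinityCommonZero.coeff_aeval_eq_zero_of_lt_two_mul` with `μ = 0`), while the
  target `t^{-N a_0} + t^{-N b_0}` has the coefficient `1` at `-N b_0 < 0`;
* with `μ < 0` the least order among the `p j` and `z_j = (p j).coeff μ` (so `z ≠ 0`, the minimiser
  contributing its leading coefficient), every `Γ_i(p)` has no coefficients below `2μ` and its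
  `t^{2μ}` coefficient is `B_i(z)`, `B_i = homogeneousComponent 2 (Γ i)`
  (`InfinityCommonZero.coeff_aeval_two_mul_eq_eval`, the lowest-order calculus of
  `PolarPeeling.coeff_prod_pow_eq`: a support monomial `d` has `|d| ≤ 2`, so `∏ (p j)^{d j}` has
  no coefficients below `|d| μ ≥ 2μ`, and at `2μ` only `|d| = 2` contributes `c_d ∏ z_j^{d j}`);
* comparing with the target, whose only coefficients are `1` at `-N b_i < -N a_i`:
  `2μ ≤ -N b_i` (else the coefficient `1` at `-N b_i < 2μ` would vanish), and if `2μ ≠ -N b_i`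
  then `2μ < -N b_i < -N a_i`, so the target's `t^{2μ}` coefficient is `0`, i.e. `B_i(z) = 0`
  (`InfinityCommonZero.le_and_eval_eq_zero_or_eq`).

Mathlib only, plus the tree file imported above (`PolarPeeling.*`, `AffinePeeling.*`).
-/

-- layout Summits/ValiantsHypothesis/ValiantsHypothesis forces the duplicated namespace component
set_option linter.dupNamespace false

namespace Summit.ValiantsHypothesis.ValiantsHypothesis.Theorems.BinomialCandidateStubs

namespace InfinityCommonZero

/-- **Nothing below `2μ`.**  If `μ ≤ 0`, no `p j` has coefficients below `μ`, and
`totalDegree Γ ≤ 2`, then `Γ(p)` has no coefficients below `2μ`: a support monomial `d` has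
`|d| ≤ 2`, so `∏_j (p j)^{d j}` has no coefficients below `|d| μ ≥ 2 μ`
(`PolarPeeling.coeff_prod_pow_eq`). -/
theorem coeff_aeval_eq_zero_of_lt_two_mul {n : ℕ} (Γ : MvPolynomial (Fin n) ℂ)
    (hΓ : Γ.totalDegree ≤ 2) (p : Fin n → LaurentSeries ℂ) (μ : ℤ) (hμ : μ ≤ 0)
    (hp : ∀ j, ∀ g < μ, (p j).coeff g = 0) :
    ∀ g < 2 * μ, (MvPolynomial.aeval p Γ).coeff g = 0 := by
  intro g hg
  rw [MvPolynomial.aeval_def, MvPolynomial.eval₂_eq', HahnSeries.coeff_sum]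
  refine Finset.sum_eq_zero fun d hd => ?_
  have hd2 : ((Finsupp.degree d : ℕ) : ℤ) ≤ 2 := by
    exact_mod_cast PolarPeeling.degree_le_of_mem_support hΓ hd
  have hlt : g < ((Finsupp.degree d : ℕ) : ℤ) * μ := by nlinarith
  rw [AffinePeeling.algebraMap_laurentSeries_apply, HahnSeries.coeff_single_zero_mul,
    (PolarPeeling.coeff_prod_pow_eq p μ hp d).1 g hlt, mul_zero]

/-- **The `t^{2μ}` coefficient.**  If `μ < 0`, no `p j` has coefficients below `μ`, and
`totalDegree Γ ≤ 2`, then the coefficient of `Γ(p)` at `2μ` is the quadratic part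
`homogeneousComponent 2 Γ` evaluated at the pole-direction vector `z_j = (p j).coeff μ`
(only the monomials of degree `2` reach down to `2μ`, `PolarPeeling.coeff_prod_pow_two_mul`). -/
theorem coeff_aeval_two_mul_eq_eval {n : ℕ} (Γ : MvPolynomial (Fin n) ℂ) (hΓ : Γ.totalDegree ≤ 2)
    (p : Fin n → LaurentSeries ℂ) (μ : ℤ) (hμ : μ < 0) (hp : ∀ j, ∀ g < μ, (p j).coeff g = 0) :
    (MvPolynomial.aeval p Γ).coeff (2 * μ) =
      MvPolynomial.eval (fun j => (p j).coeff μ) (MvPolynomial.homogeneousComponent 2 Γ) := by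
  classical
  -- adapted from the key identity inside `PolarPeeling.polar_forces_commonZero`
  rw [MvPolynomial.aeval_def, MvPolynomial.eval₂_eq', HahnSeries.coeff_sum,
    MvPolynomial.homogeneousComponent_apply, map_sum, Finset.sum_filter]
  refine Finset.sum_congr rfl fun d hd => ?_
  rw [AffinePeeling.algebraMap_laurentSeries_apply, HahnSeries.coeff_single_zero_mul,
    PolarPeeling.coeff_prod_pow_two_mul p μ hμ hp d (PolarPeeling.degree_le_of_mem_support hΓ hd),
    MvPolynomial.eval_monomial, Finsupp.prod_pow]
  split_ifs <;> simp

/-- The two-term target `t^u + t^v` (`v < u`) has coefficient `1` at `v`. -/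
theorem coeff_single_add_single_right {u v : ℤ} (h : v < u) :
    (HahnSeries.single u (1 : ℂ) + HahnSeries.single v (1 : ℂ)).coeff v = 1 := by
  rw [HahnSeries.coeff_add, HahnSeries.coeff_single_of_ne h.ne, HahnSeries.coeff_single_same,
    zero_add]

/-- The two-term target `t^u + t^v` has coefficient `0` away from `u` and `v`. -/
theorem coeff_single_add_single_of_ne {u v g : ℤ} (hu : g ≠ u) (hv : g ≠ v) :
    (HahnSeries.single u (1 : ℂ) + HahnSeries.single v (1 : ℂ)).coeff g = 0 := by
  rw [HahnSeries.coeff_add, HahnSeries.coeff_single_of_ne hu, HahnSeries.coeff_single_of_ne hv,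
    add_zero]

/-- **Comparison with the target.**  If `F = t^u + t^v` with `v < u`, `F` has no coefficients
below `ν` and its coefficient at `ν` is `B`, then `ν ≤ v` (else the coefficient `1` at `v` would
vanish) and `B = 0 ∨ ν = v` (if `ν ≠ v` then `ν < v < u`, so the coefficient of `F` at `ν`
is `0`). -/
theorem le_and_eq_zero_or_eq {F : LaurentSeries ℂ} {u v ν : ℤ} {B : ℂ} (huv : v < u)
    (hF : F = HahnSeries.single u (1 : ℂ) + HahnSeries.single v (1 : ℂ))
    (hlow : ∀ g < ν, F.coeff g = 0) (hB : F.coeff ν = B) :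
    ν ≤ v ∧ (B = 0 ∨ ν = v) := by
  subst hF
  have h1 : ν ≤ v := by
    by_contra h
    have h' := hlow v (not_le.mp h)
    rw [coeff_single_add_single_right huv] at h'
    exact one_ne_zero h'
  refine ⟨h1, ?_⟩
  rcases eq_or_ne ν v with h | h
  · exact Or.inr h
  · refine Or.inl ?_
    rw [← hB]
    exact coeff_single_add_single_of_ne (by omega) h

end InfinityCommonZero

open InfinityCommonZero in
/-- **Stub `stub_infinityCommonZero`** (crux stmt-ValiantsHypothesis-7392, line `registered`,
skeleton v4): a formal Laurent solution `p` of `Γ_i(p) = t^{-N a_i} + t^{-N b_i}` (`Γ` quadratic,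
`N ≥ 1`, `a_i < b_i`, `m ≥ 1`) has a pole; with `μ < 0` the least order among the `p j` and
`z_j = (p j).coeff μ`, one has `z ≠ 0` and, for every `i`, `2μ ≤ -N b_i` and
(`B_i(z) = 0` or `2μ = -N b_i`), where `B_i = homogeneousComponent 2 (Γ i)`. -/
theorem stub_infinityCommonZero :
    ∀ (m s : ℕ) (a b : Fin m → ℕ) (Γ : Fin m → MvPolynomial (Fin s) ℂ) (N : ℕ) (p : Fin s → LaurentSeries ℂ),
      0 < m → (∀ i, (Γ i).totalDegree ≤ 2) → 0 < N → (∀ i, a i < b i) →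
      (∀ i, MvPolynomial.aeval p (Γ i) =
        HahnSeries.single (-((N * a i : ℕ) : ℤ)) (1 : ℂ) + HahnSeries.single (-((N * b i : ℕ) : ℤ)) (1 : ℂ)) →
      ∃ μ : ℤ, μ < 0 ∧ (∀ j, ∀ g < μ, (p j).coeff g = 0) ∧ (fun j => (p j).coeff μ) ≠ 0 ∧
        ∀ i, 2 * μ ≤ -((N * b i : ℕ) : ℤ) ∧
          (MvPolynomial.eval (fun j => (p j).coeff μ) (MvPolynomial.homogeneousComponent 2 (Γ i)) = 0 ∨
            2 * μ = -((N * b i : ℕ) : ℤ)) := by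
  intro m s a b Γ N p hm hΓ hN hab hsol
  -- the exponents of the target: `-N b_i < -N a_i` and `-N b_i < 0`
  have huv : ∀ i, -((N * b i : ℕ) : ℤ) < -((N * a i : ℕ) : ℤ) := fun i =>
    neg_lt_neg (by exact_mod_cast Nat.mul_lt_mul_of_pos_left (hab i) hN)
  have hv0 : ∀ i, -((N * b i : ℕ) : ℤ) < 0 := fun i =>
    neg_lt_zero.mpr (by exact_mod_cast Nat.mul_pos hN (Nat.zero_lt_of_lt (hab i)))
  -- a pole: some `p j₀` has a nonzero coefficient at a negative exponent
  obtain ⟨j₀, g₀, hg₀, hj₀g₀⟩ : ∃ j₀ : Fin s, ∃ g₀ < (0 : ℤ), (p j₀).coeff g₀ ≠ 0 := by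
    by_contra hno
    push Not at hno
    let i₀ : Fin m := ⟨0, hm⟩
    have hlow := coeff_aeval_eq_zero_of_lt_two_mul (Γ i₀) (hΓ i₀) p 0 le_rfl hno
      (-((N * b i₀ : ℕ) : ℤ)) (by rw [mul_zero]; exact hv0 i₀)
    rw [hsol i₀, coeff_single_add_single_right (huv i₀)] at hlow
    exact one_ne_zero hlow
  have hord₀ : (p j₀).order < 0 := lt_of_le_of_lt (HahnSeries.order_le_of_coeff_ne_zero hj₀g₀) hg₀
  -- the least order `μ = (p j₁).order < 0` among the coordinates
  obtain ⟨j₁, -, hj₁⟩ :=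
    Finset.exists_min_image Finset.univ (fun j => (p j).order) ⟨j₀, Finset.mem_univ _⟩
  have hμ : (p j₁).order < 0 := lt_of_le_of_lt (hj₁ j₀ (Finset.mem_univ _)) hord₀
  have hp : ∀ j, ∀ g < (p j₁).order, (p j).coeff g = 0 := fun j g hg =>
    HahnSeries.coeff_eq_zero_of_lt_order (lt_of_lt_of_le hg (hj₁ j (Finset.mem_univ _)))
  have hz : (fun j => (p j).coeff (p j₁).order) ≠ 0 := by
    intro h
    have h1 : p j₁ = 0 := HahnSeries.coeff_order_eq_zero.mp (congr_fun h j₁)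
    rw [h1, HahnSeries.order_zero] at hμ
    exact lt_irrefl _ hμ
  refine ⟨(p j₁).order, hμ, hp, hz, fun i => ?_⟩
  exact le_and_eq_zero_or_eq (huv i) (hsol i)
    (coeff_aeval_eq_zero_of_lt_two_mul (Γ i) (hΓ i) p _ hμ.le hp)
    (coeff_aeval_two_mul_eq_eval (Γ i) (hΓ i) p _ hμ hp)

end Summit.ValiantsHypothesis.ValiantsHypothesis.Theorems.BinomialCandidateStubs
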